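import Literature.NumberTheory.IwasawaTheory.Greenberg2006.GaloisCohomologyStructure
import Literature.NumberTheory.GaloisRepresentations.LocalDualityTwoZeroSeparation
import Literature.NumberTheory.GaloisRepresentations.ContinuousH2FiniteLevels
import Literature.NumberTheory.GaloisRepresentations.ContinuousCohomologyRestrictScalars
import Literature.NumberTheory.GaloisRepresentations.LocalGlobalCohomologyTateProofs
import HarnessLib

/-!
# Greenberg 2006 §5 A, consumed form: `LOC_v⁽¹⁾(𝒟) ⟹ H²(K_v, 𝒟) = 0` — PROOF of the named fact
# `Greenberg2006.sec5A_localH2_subsingleton_of_LOC1`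

R. Greenberg, *On the structure of certain Galois cohomology groups*, Doc. Math. Extra Vol. Coates
(2006), §5 A (p. 372 L93 – p. 373 L10): for a non-archimedean prime `v` and a discrete (cofinitely
generated) `Λ`-module `𝒟` with a `Λ`-linear action of `G_{K_v}`, "the Pontryagin dual of
`(T*)^{G_{K_v}} = H⁰(K_v, T*)` is `H²(K_v, 𝒟)`", `T* = Hom(𝒟, μ_{p^∞})`; the tree types the CONSUMED
IMPLICATION (`GaloisCohomologyStructure.lean`, `sec5A_localH2_subsingleton_of_LOC1`): if every
`Γ_{K_v}`-equivariant additive `𝒟 → K̄ˣ` vanishes (LOC_v⁽¹⁾, `Greenberg2016.LOC1`), then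
`H²(K_v, 𝒟) = 0`. This file PROVES it (`sec5A_localH2_subsingleton_of_LOC1_holds`), for the tree's
objects: Mathlib's continuous cohomology of `Γ_{K_v} = Gal(K̄_v/K_v)`, `K_v = v.adicCompletion K`,
acting on the discrete `𝒟` through `Γ_{K_v} → Γ_K → G_{K,Σ}`.

PROOF (local Tate duality in the limit, at the level of continuous cochains). `H²` does not see the
scalars, so work over `ℤ` (`ContinuousRep.subsingleton_H_two_restrictScalars_iff`); it vanishes iff
every continuous inhomogeneous `2`-cocycle `c : Γ² → 𝒟` is a continuous coboundary. Such a `c` takes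
finitely many values (compactness of `Γ_{K_v}`), hence is valuewise a cocycle `c_W` of a FINITE
`Γ`-stable submodule `W ⊇ W₁`, `W₁` generated by its values (`contTwoCocycles.exists_finite_level`,
Serre I §2.2 Cor. 2). If `[c_W] = 0` for some finite stable `W ⊇ W₁`, `c` is a coboundary. Otherwise
`[c_W] ≠ 0` for all of them; `W` being finite and `p`-primary, local Tate duality in bidegree `(2, 0)`
over `K_v` (the tree's PROVED `natCard_two_eq_natCard_invariants_homRep`, in the separating form
`ContinuousRep.exists_invariant_cohomologyMap_two_ne_zero`) yields a `Γ_{K_v}`-invariant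
`f_W ∈ Hom(W, μ_{p^k}(K̄_v))` with `H²(ev_{f_W}) [c_W] ≠ 0`; through `μ_{p^k}(K̄_v) ≅ μ_{p^k}(K̄) ⊂ K̄ˣ`
(`muTransferEquiv`, equivariant for `Γ_{K_v} → Γ_K`) this is an equivariant `h_W : W → K̄ˣ` whose
restriction to `W₁` "detects `[c_{W₁}]`". Equivariant maps `W → K̄ˣ` on a finite level form a finite
set, so König's lemma over the directed system of finite stable submodules
(`ContinuousRep.exists_equivariant_hom_of_finite_levels`) glues them to an equivariant `h : 𝒟 → K̄ˣ`
still detecting `[c_{W₁}]`, in particular `h ≠ 0` — contradicting LOC_v⁽¹⁾. (Neither the cofinite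
generation of `𝒟` nor the shape of `Λ` is used.)

Discharges the named fact for its consumers (`stub_greenberg2016FactsSS` of line `bdpline` on
stmt-BirchSwinnertonDyer-20727, `…FiniteExponentTelescope.finiteExponent_of_bricks`; route
EisensteinPrimes' `…TwistDeformationFullAtSelmerOfFacts`; cell `bsd-eis` road γ). Theorems only; no
definition, no new named fact, no `sorry`.

## References
* [Greenberg2006] R. Greenberg, Doc. Math. Extra Vol. Coates (2006) 335–391, §5 A (pp. 372–373).
* [SerreGaloisCohomology1997] J.-P. Serre, *Galois Cohomology* (1997), I §2.2 Cor. 2; II §5.2 Thm. 2.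
* [MilneADT2006] J. S. Milne, *Arithmetic Duality Theorems* (2006), I Cor. 2.3.
-/

noncomputable section

open scoped Classical
open CategoryTheory Function NumberField IsDedekindDomain Field
open Literature.NumberTheory.GaloisRepresentations
open Literature.NumberTheory.GaloisRepresentations.DiscreteGaloisModule
open Literature.NumberTheory.IwasawaTheory.Greenberg2016
open _root_.TopRep _root_.ContRepresentation _root_.ContinuousCohomology

universe u

namespace Literature.NumberTheory.IwasawaTheory.Greenberg2006

/-! ### §1. Helpers -/

/-- A finite `p`-primary abelian group is killed by a single power of `p` (private helper).
[folklore] -/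
private theorem exists_pow_nsmul_eq_zero {p : ℕ} [Fact p.Prime] (B : Type*) [AddCommGroup B]
    [Finite B] (hB : IsPrimaryTorsion p B) : ∃ k : ℕ, ∀ b : B, p ^ k • b = 0 := by
  obtain ⟨m, hm⟩ := exists_card_eq_prime_pow B hB
  exact ⟨m, fun b => addOrderOf_dvd_iff_nsmul_eq_zero.1 (hm ▸ addOrderOf_dvd_natCard b)⟩

/-- The additive maps from a finite group of exponent `p^k` to `K̄ˣ` form a finite set (they take
values in `μ_{p^k}(K̄)`; private helper). [folklore] -/
private theorem finite_addMonoidHom_unitsCarrier (K : Type u) [Field K] [CharZero K] {p k : ℕ}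
    [hp : Fact p.Prime] (W : Type u) [AddCommGroup W] [Finite W] (hW : ∀ w : W, p ^ k • w = 0) :
    Finite (W →+ UnitsCarrier K) := by
  haveI : NeZero (p ^ k) := ⟨pow_ne_zero k hp.out.ne_zero⟩
  haveI : Finite (MuCarrier K (p ^ k)) :=
    Nat.finite_of_card_ne_zero (by rw [natCard_muCarrier]; exact NeZero.ne _)
  have hpow : ∀ (h : W →+ UnitsCarrier K) (w : W), unitsVal K (h w) ^ (p ^ k) = 1 := by
    intro h w
    rw [← zpow_natCast, ← unitsVal_zsmul, natCast_zsmul, ← map_nsmul, hW w, map_zero]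
    rfl
  refine Finite.of_injective
    (fun h : W →+ UnitsCarrier K => fun w => muOfUnit K (p ^ k) (unitsVal K (h w)) (hpow h w))
    fun h h' e => ?_
  refine AddMonoidHom.ext fun w => unitsVal_injective K ?_
  have e' := congrArg (muVal K (p ^ k)) (congrFun e w)
  rwa [muVal_muOfUnit, muVal_muOfUnit] at e'

/-- `μ_n(K̄_F) ≅ μ_n(K̄)` (inverse of `muTransferEquiv`) is `Γ_F`-equivariant for `Γ_F → Γ_K`
(private helper). [folklore] -/
private theorem muTransferEquiv_symm_mu (K F : Type u) [Field K] [Field F] [Algebra K F]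
    [CharZero K] [CharZero F] (n : ℕ) [NeZero n] (σ : absoluteGaloisGroup F) (y : MuCarrier F n) :
    (muTransferEquiv K F n).symm (mu F n σ y) =
      mu K n (absGaloisRestrict K F σ) ((muTransferEquiv K F n).symm y) := by
  apply (muTransferEquiv K F n).injective
  rw [AddEquiv.apply_symm_apply, muTransferEquiv_apply, muTransfer_mu, ← muTransferEquiv_apply,
    AddEquiv.apply_symm_apply]

/-! ### §2. The local vanishing over `ℤ` -/

/-- **`H²(F, 𝒟) = 0` from LOC⁽¹⁾, cocycle form, over `ℤ`.** For a non-archimedean local field `F` of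
characteristic `0` given as a `K`-algebra (`K` a field of characteristic `0`, e.g. the number field of
which `F` is a completion), a discrete `p`-primary `Γ_F`-module `𝒟` (continuous action `ρ`) such that
every additive `𝒟 → K̄ˣ` equivariant for `Γ_F → Γ_K` vanishes, every continuous inhomogeneous
`2`-cocycle of `Γ_F` with values in `𝒟` has trivial class. See the module docstring for the proof
(Serre I §2.2 Cor. 2 + local Tate duality `(2, 0)` on the finite levels + König).
[cite: Greenberg2006, §5 A (p. 372 L93 – p. 373 L10)] -/
theorem twoCocycleClass_eq_zero_of_LOC1 (K F : Type u) [Field K] [CharZero K] [Field F] [Algebra K F]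
    [ValuativeRel F] [TopologicalSpace F] [IsNonarchimedeanLocalField F] [CharZero F]
    {p : ℕ} [hp : Fact p.Prime] {D : Type u} [AddCommGroup D] [TopologicalSpace D] [DiscreteTopology D]
    (ρ : ContinuousRep (absoluteGaloisGroup F) ℤ D) (hD : IsPrimaryTorsion p D)
    (hLOC : ∀ h : D →+ UnitsCarrier K,
      (∀ (σ : absoluteGaloisGroup F) (d : D), h (ρ σ d) = units K (absGaloisRestrict K F σ) (h d)) → h = 0)
    (c : contTwoCocycles ρ.toTopRep) : twoCocycleClass ρ.toTopRep c = 0 := by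
  haveI := absoluteGaloisGroup_compactSpace F
  have hp0 : p ≠ 0 := hp.out.ne_zero
  -- the cocycle lives on a finite stable submodule `W₁`
  obtain ⟨W₁, hW₁, c₁, hfin₁, hc₁⟩ := contTwoCocycles.exists_finite_level ρ hp0 hD c
  haveI := hfin₁
  by_cases hA : ∃ (W : Submodule ℤ D) (hW : ∀ g, W ≤ W.comap (ρ g))
      (c' : contTwoCocycles (ρ.subrepresentation W hW).toTopRep),
      (∀ x, (c'.1 x : D) = c.1 x) ∧ twoCocycleClass _ c' = 0
  · obtain ⟨W, hW, c', hc', h0⟩ := hA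
    exact twoCocycleClass_eq_zero_of_level ρ c hW c' hc' h0
  exfalso
  push Not at hA
  -- the bare action of `Γ_F` on `K̄ˣ` and the detecting property on `W₁`
  let act : absoluteGaloisGroup F → UnitsCarrier K → UnitsCarrier K :=
    fun σ u => units K (absGaloisRestrict K F σ) u
  let P : (W₁ →+ UnitsCarrier K) → Prop := fun h₁ =>
    ∃ (k : ℕ) (f : HomCarrier W₁ (MuCarrier F (p ^ k)))
      (hf : ∀ g, (ρ.subrepresentation W₁ hW₁).homRep (mu F (p ^ k)) g f = f),
      (haveI : NeZero (p ^ k) := ⟨pow_ne_zero k hp0⟩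
       ∀ x : W₁, h₁ x = kummerInclAddHom K (p ^ k) ((muTransferEquiv K F (p ^ k)).symm (f x))) ∧
      cohomologyMap (((ρ.subrepresentation W₁ hW₁).evalPairing (mu F (p ^ k))).flip.leftHom f hf) 2
        (twoCocycleClass _ c₁) ≠ 0
  -- finiteness of the equivariant maps on a finite level
  have hfin : ∀ (W : Submodule ℤ D) (hW : ∀ g, W ≤ W.comap (ρ g)), Finite W →
      Set.Finite {h : W →+ UnitsCarrier K |
        ∀ (g : absoluteGaloisGroup F) (w : W), h (ρ.subrepresentation W hW g w) = act g (h w)} := by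
    intro W hW hWfin
    obtain ⟨k, hk⟩ := exists_pow_nsmul_eq_zero (p := p) W (hD.submodule W)
    haveI := finite_addMonoidHom_unitsCarrier K W hk
    exact Set.toFinite _
  -- non-emptiness: local Tate duality `(2, 0)` on the finite level `W`
  have hne : ∀ (W : Submodule ℤ D) (hW : ∀ g, W ≤ W.comap (ρ g)) (hle : W₁ ≤ W), Finite W →
      ∃ h : W →+ UnitsCarrier K,
        (∀ (g : absoluteGaloisGroup F) (w : W), h (ρ.subrepresentation W hW g w) = act g (h w)) ∧
        P (h.comp (Submodule.inclusion hle).toAddMonoidHom) := by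
    intro W hW hle hWfin
    obtain ⟨k, hk⟩ := exists_pow_nsmul_eq_zero (p := p) W (hD.submodule W)
    haveI : NeZero (p ^ k) := ⟨pow_ne_zero k hp0⟩
    -- the cocycle at level `W` and its non-zero class
    obtain ⟨cW, hcW⟩ := contTwoCocycles.exists_codRestrict ρ c W hW fun x => hle (by
      rw [← hc₁ x]; exact (c₁.1 x).2)
    have hz : twoCocycleClass _ cW ≠ 0 := hA W hW cW hcW
    -- local Tate duality: an invariant `f_W : W → μ_{p^k}(K̄_F)` detecting the class
    obtain ⟨fW, hfW, hdet⟩ :=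
      ContinuousRep.exists_invariant_cohomologyMap_two_ne_zero F (ρ.subrepresentation W hW) hk hz
    have hfW' : ∀ (g : absoluteGaloisGroup F) (w : W),
        mu F (p ^ k) g (fW w) = fW (ρ.subrepresentation W hW g w) :=
      fun g => (ContinuousRep.homRep_apply_eq_self_iff _ _ g fW).1 (hfW g)
    -- transport to `K̄ˣ`
    let e := muTransferEquiv K F (p ^ k)
    let hWmap : W →+ UnitsCarrier K :=
      (kummerInclAddHom K (p ^ k)).comp (e.symm.toAddMonoidHom.comp (fW : W →+ MuCarrier F (p ^ k)))
    have hWmap_apply : ∀ w : W, hWmap w = kummerInclAddHom K (p ^ k) (e.symm (fW w)) := fun _ => rfl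
    refine ⟨hWmap, fun g w => ?_, ?_⟩
    · -- equivariance
      apply unitsVal_injective K
      rw [hWmap_apply, hWmap_apply, unitsVal_kummerInclAddHom, ← hfW' g w,
        muTransferEquiv_symm_mu K F (p ^ k) g (fW w)]
      change _ = unitsVal K (units K (absGaloisRestrict K F g) _)
      rw [unitsVal_apply, unitsVal_kummerInclAddHom, muVal_apply]
    · -- the detecting property on `W₁`
      obtain ⟨φ, hφ⟩ := ρ.exists_inclusionHom hW₁ hW hle
      let f : HomCarrier W₁ (MuCarrier F (p ^ k)) :=
        HomCarrier.ofAddMonoidHom ((fW : W →+ MuCarrier F (p ^ k)).comp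
          (Submodule.inclusion hle).toAddMonoidHom)
      have hf_apply : ∀ x : W₁, f x = fW (Submodule.inclusion hle x) := fun _ => rfl
      have hf : ∀ g, (ρ.subrepresentation W₁ hW₁).homRep (mu F (p ^ k)) g f = f := fun g =>
        (ContinuousRep.homRep_apply_eq_self_iff _ _ g f).2 fun x => by
          rw [hf_apply, hf_apply, hfW' g]
          rfl
      refine ⟨k, f, hf, fun x => rfl, fun h0 => hdet ?_⟩
      -- `H²(ev_{f_W}) [c_W] = H²(ev_f) [c₁]`
      have e1 : cohomologyMap (((ρ.subrepresentation W hW).evalPairing (mu F (p ^ k))).flip.leftHom fW hfW) 2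
            (twoCocycleClass _ cW) =
          cohomologyMap (((ρ.subrepresentation W₁ hW₁).evalPairing (mu F (p ^ k))).flip.leftHom f hf) 2
            (twoCocycleClass _ c₁) := by
        rw [cohomologyMap_twoCocycleClass, cohomologyMap_twoCocycleClass]
        refine congrArg _ (Subtype.ext (ContinuousMap.ext fun x => ?_))
        rw [pullback₂_id_resIdHom_apply, pullback₂_id_resIdHom_apply, ContPairing.leftHom_hom_apply,
          ContPairing.leftHom_hom_apply]
        change fW (cW.1 x) = f (c₁.1 x)
        rw [hf_apply]
        exact congrArg fW (Subtype.ext ((hcW x).trans (hc₁ x).symm))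
      rw [e1, h0]
  -- König: an equivariant `h : 𝒟 → K̄ˣ` detecting `[c₁]`
  obtain ⟨h, hequiv, k, f, hf, hres, hdet⟩ :=
    ContinuousRep.exists_equivariant_hom_of_finite_levels ρ act P hD hW₁ hfin hne
  -- LOC⁽¹⁾ kills `h`, hence `f`, hence `H²(ev_f) [c₁]`
  have h0 : h = 0 := hLOC h hequiv
  haveI : NeZero (p ^ k) := ⟨pow_ne_zero k hp0⟩
  have hf0 : ∀ x : W₁, f x = 0 := by
    intro x
    have hx : kummerInclAddHom K (p ^ k) ((muTransferEquiv K F (p ^ k)).symm (f x)) = 0 := by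
      rw [← hres x]
      change h (x : D) = 0
      rw [h0, AddMonoidHom.zero_apply]
    have hx' : (muTransferEquiv K F (p ^ k)).symm (f x) = 0 := by
      apply muVal_injective K (p ^ k)
      rw [← unitsVal_kummerInclAddHom, hx, muVal_zero]
      rfl
    simpa using congrArg (muTransferEquiv K F (p ^ k)) hx'
  apply hdet
  rw [cohomologyMap_twoCocycleClass]
  convert twoCocycleClass_zero (mu F (p ^ k)).toTopRep using 2
  refine Subtype.ext (ContinuousMap.ext fun x => ?_)
  rw [pullback₂_id_resIdHom_apply, ContPairing.leftHom_hom_apply]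
  exact hf0 (c₁.1 x)

/-! ### §3. The named fact -/

/-- **Greenberg 2006, §5 A (consumed implication) — PROVED**: for every `p`, number field `K`, finite
set `S ⊇ {v ∣ p}`, coefficient ring `Λ`, discrete `p`-primary `𝒟` with a continuous `Λ`-linear action
of `G_{K,S}`, and finite place `v`: if `LOC_v⁽¹⁾(𝒟)` holds (every `Γ_{K_v}`-equivariant additive
`𝒟 → K̄ˣ` is zero) then `H²(K_v, 𝒟) = 0`. Discharges
`Greenberg2006.sec5A_localH2_subsingleton_of_LOC1` (see the module docstring; the printed source is
the duality "`H²(K_v, 𝒟)` is Pontryagin dual to `(T*)^{G_{K_v}}`", local Tate duality in the limit).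
[cite: Greenberg2006, §5 A (p. 372 L93 – p. 373 L10; p. 373 L44–45)] -/
theorem sec5A_localH2_subsingleton_of_LOC1_holds : sec5A_localH2_subsingleton_of_LOC1 := by
  intro p _ K _ _ S _ _ Λ _ _ _ mΛ _ D _ _ _ _ _ ρ hpD _ v hLOC
  -- the local field `K_v`
  letI : ValuativeRel (NumberField.Place.Completion (Sum.inr v : NumberField.Place K)) :=
    inferInstanceAs (ValuativeRel (v.adicCompletion K))
  letI : TopologicalSpace (NumberField.Place.Completion (Sum.inr v : NumberField.Place K)) :=
    inferInstanceAs (TopologicalSpace (v.adicCompletion K))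
  haveI : IsNonarchimedeanLocalField (NumberField.Place.Completion (Sum.inr v : NumberField.Place K)) :=
    inferInstanceAs (IsNonarchimedeanLocalField (v.adicCompletion K))
  haveI : CharZero (NumberField.Place.Completion (Sum.inr v : NumberField.Place K)) :=
    charZero_of_injective_algebraMap
      (algebraMap K (NumberField.Place.Completion (Sum.inr v : NumberField.Place K))).injective
  haveI := absoluteGaloisGroup_compactSpace (NumberField.Place.Completion (Sum.inr v : NumberField.Place K))
  have hD : IsPrimaryTorsion p D := fun d => by
    obtain ⟨n, hn⟩ := hpD d
    refine ⟨n, ?_⟩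
    rw [← natCast_zsmul, Nat.cast_pow]
    exact hn
  -- over `ℤ`, on cocycles
  rw [← ContinuousRep.subsingleton_H_two_restrictScalars_iff ℤ (localRep S ρ (Sum.inr v))]
  change Subsingleton (continuousCohomology 2 ((localRep S ρ (Sum.inr v)).restrictScalars ℤ).toTopRep)
  rw [subsingleton_continuousCohomology_two_iff_forall_twoCocycle]
  intro f hf
  exact (twoCocycleClass_eq_zero_iff _ ⟨f, hf⟩).1
    (twoCocycleClass_eq_zero_of_LOC1 K (NumberField.Place.Completion (Sum.inr v : NumberField.Place K))
      ((localRep S ρ (Sum.inr v)).restrictScalars ℤ) hD hLOC ⟨f, hf⟩)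

end Literature.NumberTheory.IwasawaTheory.Greenberg2006

end
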